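import Mathlib
import Summits.ValiantsHypothesis.ValiantsHypothesis.Theses.BarrierLever
import Literature.Barriers.ValiantsHypothesis.AlgebraicNaturalProofs
import Summits.ValiantsHypothesis.ValiantsHypothesis.Theorems.BarrierLeverSuccinctHittingSetsForVPLevelOne
import Summits.ValiantsHypothesis.ValiantsHypothesis.Theorems.BarrierLeverSuccinctHittingSetsForVPSparse
import Summits.ValiantsHypothesis.ValiantsHypothesis.Theorems.BarrierLeverSuccinctHittingSetsForVPHomogeneous
import HarnessLib

/-!
# Crux `BarrierLever.SuccinctHittingSetsForVP` (stmt-ValiantsHypothesis-14610), line `registered` —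
THE SHARPENED HEART: HOMOGENEOUS, SUPER-DENSE, LEVEL FOUR (lead c4)

**What is proved (unconditional; a REDUCTION, it does NOT close the item).** Combining the lead's
homogeneous reduction (`Homogeneous`, p164794) with the landed sparse master theorem (FSV18 Cor. 34 in
regime `d = n`, `Sparse.isSuccinctHittingSet_card_support_lt_of_le`, p152812):

* `levelOne_of_heart` : if for some `b`, eventually in `n`, `SmallCircuits ℂ n b` hits every nonzero
  distinguisher that is SIMULTANEOUSLY of level `4` (size and degree `≤ N⁴`), HOMOGENEOUS, and
  SUPER-DENSE (`> 2^(n^(b-3))` monomials), then level one of FSV Question 6 holds (size exponent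
  `b + 1`) — hence every level.
* `succinctHittingSetsForVP_iff_heart` : the crux is EQUIVALENT to that statement.
* `exists_heart_equation` : contrapositive at fixed `n` — a level-one equation for
  `SmallCircuits ℂ n (b+1)` (`n, b ≥ 4`) yields a homogeneous, super-dense, level-4 equation for
  `SmallCircuits ℂ n b` (a homogeneous component; it is an equation, hence super-dense by Cor. 34).

So a counterexample to the crux may be assumed homogeneous AND to have exponentially many monomials,
at the cost of three levels of constructivity and one size exponent. Axioms: `propext`,
`Classical.choice`, `Quot.sound`.

References: [ForbesShpilkaVolk2018] Question 6, Lemma 32, Cor. 34; BCS (7.1).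
-/

-- layout Summits/ValiantsHypothesis/ValiantsHypothesis forces the duplicated namespace component
set_option linter.dupNamespace false

namespace Summit.ValiantsHypothesis.ValiantsHypothesis.Theorems.BarrierLever.SuccinctHittingSetsForVP

open Literature.Barriers.ValiantsHypothesis Literature.Computability.AlgebraicComplexity MvPolynomial
open Homogeneous

/-- **A homogeneous, super-dense, level-4 equation from a level-one equation** (`n, b ≥ 4`): if a
nonzero level-one `D` vanishes on `SmallCircuits ℂ n (b+1)`, some homogeneous component `E` of `D` is a
nonzero homogeneous level-4 distinguisher vanishing on `SmallCircuits ℂ n b`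
(`exists_homogeneous_equation`), and as an equation it has more than `2^(n^(b-3))` monomials
(`Sparse.two_pow_pow_lt_card_support_of_vanishes`). [cite: ForbesShpilkaVolk2018, Cor. 34 and Question 6] -/
theorem exists_heart_equation {n b : ℕ} (hn : 4 ≤ n) (hb : 4 ≤ b)
    {D : MvPolynomial (degLEMonomials n) ℂ} (hD : D ∈ Distinguishers ℂ n 1) (hD0 : D ≠ 0)
    (hvan : ∀ f ∈ SmallCircuits ℂ n (b + 1), eval (coeffVector (degLEMonomials n) f) D = 0) :
    ∃ E ∈ Distinguishers ℂ n 4, E ≠ 0 ∧ E.IsHomogeneous E.totalDegree ∧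
      2 ^ (n ^ (b - 3)) < E.support.card ∧
      ∀ f ∈ SmallCircuits ℂ n b, eval (coeffVector (degLEMonomials n) f) E = 0 := by
  obtain ⟨E, hE, hE0, hhom, hEvan⟩ := exists_homogeneous_equation (by omega) hD hD0 hvan
  exact ⟨E, hE, hE0, hhom, Sparse.two_pow_pow_lt_card_support_of_vanishes hn hb hE0 hEvan, hEvan⟩

/-- **Level one from the sharpened heart.** If for some `b`, eventually in `n`, `SmallCircuits ℂ n b`
hits every nonzero homogeneous super-dense level-4 distinguisher, then level one holds with size
exponent `max b 4 + 1`. [cite: ForbesShpilkaVolk2018, Question 6 and Cor. 34] -/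
theorem levelOne_of_heart
    (h : ∃ b n₀ : ℕ, ∀ n : ℕ, n₀ ≤ n →
      IsSuccinctHittingSet (degLEMonomials n) (SmallCircuits ℂ n b)
        (Distinguishers ℂ n 4 ∩ {D | D.IsHomogeneous D.totalDegree} ∩
          {D | 2 ^ (n ^ (b - 3)) < D.support.card})) :
    ∃ b n₀ : ℕ, ∀ n : ℕ, n₀ ≤ n →
      IsSuccinctHittingSet (degLEMonomials n) (SmallCircuits ℂ n b) (Distinguishers ℂ n 1) := by
  obtain ⟨b, n₀, hb⟩ := h
  -- move to b' = max b 4 (the residual class shrinks, the simple class grows)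
  set b' := max b 4 with hb'
  refine ⟨b' + 1, max n₀ 4, fun n hn D hD hD0 => ?_⟩
  have hn₀ : n₀ ≤ n := le_trans (le_max_left _ _) hn
  have hn4 : 4 ≤ n := le_trans (le_max_right _ _) hn
  by_contra hnot
  push Not at hnot
  -- `D` is a level-one equation for `SmallCircuits ℂ n (b'+1)`
  have hvan : ∀ f ∈ SmallCircuits ℂ n (b' + 1), eval (coeffVector (degLEMonomials n) f) D = 0 :=
    fun f hf => hnot f hf
  obtain ⟨E, hE, hE0, hhom, hdense, hEvan⟩ := exists_heart_equation hn4 (le_max_right b 4) hD hD0 hvan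
  -- `E` is hit at exponent `b`: contradiction
  have hdense_b : 2 ^ (n ^ (b - 3)) < E.support.card :=
    lt_of_le_of_lt (Nat.pow_le_pow_right (by norm_num)
      (Nat.pow_le_pow_right (by omega) (by omega))) hdense
  obtain ⟨f, hf, hne⟩ := hb n hn₀ E ⟨⟨hE, hhom⟩, hdense_b⟩ hE0
  exact hne (hEvan f (smallCircuits_mono ℂ (le_max_left b 4) (by omega) hf))

/-- **The crux is equivalent to its sharpened heart**: FSV Question 6 over `ℂ` (regime `d = n`) holds
iff for some `b`, eventually in `n`, the coefficient vectors of `SmallCircuits ℂ n b` hit every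
nonzero distinguisher of size and degree `≤ N⁴` that is homogeneous and has more than `2^(n^(b-3))`
monomials. [cite: ForbesShpilkaVolk2018, Question 6] -/
theorem succinctHittingSetsForVP_iff_heart :
    Summit.ValiantsHypothesis.ValiantsHypothesis.Theses.BarrierLever.SuccinctHittingSetsForVP ↔
      ∃ b n₀ : ℕ, ∀ n : ℕ, n₀ ≤ n →
        IsSuccinctHittingSet (degLEMonomials n) (SmallCircuits ℂ n b)
          (Distinguishers ℂ n 4 ∩ {D | D.IsHomogeneous D.totalDegree} ∩
            {D | 2 ^ (n ^ (b - 3)) < D.support.card}) := by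
  constructor
  · intro h
    obtain ⟨b, n₀, hb⟩ := (show Literature.Barriers.ValiantsHypothesis.SuccinctHittingSetsForVP ℂ from h) 4
    exact ⟨b, n₀, fun n hn => (hb n hn).mono le_rfl
      (Set.inter_subset_left.trans Set.inter_subset_left)⟩
  · intro h
    exact succinctHittingSetsForVP_iff_levelOne.mpr (levelOne_of_heart h)

/-- **Registered stub `stub_heartReduction`** (crux stmt-ValiantsHypothesis-14610, line `registered`;
lead c4): the sharpened heart implies level one (arrow form of `succinctHittingSetsForVP_iff_heart`).
[cite: ForbesShpilkaVolk2018, Question 6] -/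
theorem stub_heartReduction :
    (∃ b n₀ : ℕ, ∀ n : ℕ, n₀ ≤ n →
      IsSuccinctHittingSet (degLEMonomials n) (SmallCircuits ℂ n b)
        (Distinguishers ℂ n 4 ∩ {D | D.IsHomogeneous D.totalDegree} ∩
          {D | 2 ^ (n ^ (b - 3)) < D.support.card})) →
    ∃ b n₀ : ℕ, ∀ n : ℕ, n₀ ≤ n →
      IsSuccinctHittingSet (degLEMonomials n) (SmallCircuits ℂ n b) (Distinguishers ℂ n 1) :=
  levelOne_of_heart

end Summit.ValiantsHypothesis.ValiantsHypothesis.Theorems.BarrierLever.SuccinctHittingSetsForVP
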